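import Literature.Analysis.FluidPDE.TorusNSVectorFieldHolder
import HarnessLib

/-!
# Hölder continuity in `H¹` of the projected Navier–Stokes vector field on Gevrey balls of `T³`
# (tools stub `stub_vectorFieldHolderTools`, block N-R T3, line `ergodic-budget-selection-closing`,
# crux `BaireTransfer.DenseLoudDesignerForces`, stmt-AnomalousDissipation-1143)

Summit-side specialisation to `T³ = UnitAddTorus (Fin 3)` of the Literature theorem
`Torus.exists_h1_nsVectorField_sub_le_sqrt_of_gevreyBound` (`Literature/Analysis/FluidPDE/TorusNSVectorFieldHolder.lean`):
for real `ν, σ, C` with `σ > 0` there is `K = K(ν, σ, C)` such that for all smooth zero-mean fields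
`u₁, u₂ : T³ → ℝ³` on the Gevrey ball `∑_{k∈S} e^{2σ|k|} ‖ûⱼ(k)‖² ≤ C` (all finite `S ⊆ ℤ³`; the classes
`D(e^{σA^{1/2}})` of Foias–Temam 1989, produced along bounded-enstrophy Navier–Stokes trajectories by the Gevrey
smoothing tools of block N) the projected Navier–Stokes vector field `G(u) = νΔu − P((u·∇)u)`,
`P v = v − ∇Δ⁻¹ div v` (the smooth Leray–Helmholtz projection), satisfies the Hölder-½ estimate in `H¹`

  `∫ ‖G(u₁) − G(u₂)‖² + ‖∇(G(u₁) − G(u₂))‖₂² ≤ K · (∫ ‖u₁ − u₂‖² + ‖∇(u₁ − u₂)‖₂²)^{1/2}`.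

Proof (in the Literature files, general `d` with `card d = 3`): `G(u₁) − G(u₂) = νΔδ − P((u₁·∇)δ + (δ·∇)u₂)`,
`δ = u₁ − u₂`; `P` is an `L²`- and `H¹`-contraction (`Literature/Analysis/FunctionSpaces/TorusLerayHelmholtzH1.lean`,
Pythagoras for `w + ∇φ` at the `H¹` level); the `H¹` product estimates of the linearised inertial term with sup
norms of `u₁, u₂` from the Gevrey bound (`TorusGevreySobolevBounds`) and the `T³` sup bound of the zero-mean `δ`
give `LHS ≤ K₀ (‖δ‖₂² + ‖∇δ‖₂² + ‖Δδ‖₂² + ‖∇Δδ‖₂²)`; the Cauchy–Schwarz interpolations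
`‖Δδ‖₂² ≤ ‖∇δ‖₂‖∇Δδ‖₂`, `‖∇Δδ‖₂² ≤ ‖∇δ‖₂‖∇Δ²δ‖₂` (`TorusSobolevInterpolationCS`, tools stub T2) with the Gevrey
bounds on `‖∇Δδ‖₂², ‖∇Δ²δ‖₂²` bring this down to `K ‖δ‖_{H¹}`.  The divergence-free hypotheses of the registered
signature are not needed by the estimate and are discarded.  The registered tools stub `stub_vectorFieldHolderTools`
is proved BY NAME with exactly the registered signature.

References: Robinson–Rodrigo–Sadowski, *The Three-Dimensional Navier–Stokes Equations* (CUP 2016) Thm. 2.6,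
Lemma 2.9, proof of Thm 7.1; Constantin–Foias, *Navier–Stokes Equations* (1988) Ch. 4–6; Foias–Temam,
J. Funct. Anal. 87 (1989).
-/

-- `Summit.<Summit>.<Problem>` is the tree's mandated summit-side namespace (CONVENTIONS §2); for this
-- single-conjunct summit the two coincide, so the duplicate is deliberate.
set_option linter.dupNamespace false

noncomputable section

open Set Function MeasureTheory Filter
open scoped InnerProductSpace

namespace Summit.AnomalousDissipation.AnomalousDissipation.Theorems.DenseLoudDesignerForces.Ergodic

open Literature.Analysis.FunctionSpaces Literature.Analysis.FunctionSpaces.Torus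
open Literature.Analysis.FluidPDE Literature.Analysis.FluidPDE.Torus

/-- **Tools stub T3 of block N-R (`stub_vectorFieldHolderTools`, crux stmt-AnomalousDissipation-1143, line
`ergodic-budget-selection-closing`) — Hölder-½ continuity in `H¹` of the projected Navier–Stokes vector field on a
Gevrey ball of `T³`.**  For real `ν, σ, C` with `σ > 0` there is `K` such that for all smooth divergence-free
zero-mean `u₁, u₂ : T³ → ℝ³` with `∑_{k∈S} e^{2σ|k|} ‖ûⱼ(k)‖² ≤ C` for all finite `S`, the field
`G(u) = νΔu − ((u·∇)u − ∇Δ⁻¹div((u·∇)u))` satisfies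
`∫ ‖G(u₁) − G(u₂)‖² + gradNormSq (G(u₁) − G(u₂)) ≤ K · (∫ ‖u₁ − u₂‖² + gradNormSq (u₁ − u₂))^{1/2}`
(`Torus.exists_h1_nsVectorField_sub_le_sqrt_of_gevreyBound` at `d = Fin 3`; the divergence-free hypotheses are
not used). [folklore] -/
theorem stub_vectorFieldHolderTools (ν σ C : ℝ) (hσ : 0 < σ) :
    ∃ K : ℝ, ∀ (u₁ u₂ : (UnitAddTorus (Fin 3)) → (EuclideanSpace ℝ (Fin 3))), IsSmooth u₁ → IsSmooth u₂ → IsDivFree u₁ → IsDivFree u₂ →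
      HasZeroMean u₁ → HasZeroMean u₂ →
      (∀ S' : Finset (Fin 3 → ℤ), ∑ k ∈ S', Real.exp (2 * σ * Real.sqrt (freqNormSq k)) *
        ‖UnitAddTorus.mFourierCoeff (EuclideanSpace.complexify ∘ u₁) k‖ ^ 2 ≤ C) →
      (∀ S' : Finset (Fin 3 → ℤ), ∑ k ∈ S', Real.exp (2 * σ * Real.sqrt (freqNormSq k)) *
        ‖UnitAddTorus.mFourierCoeff (EuclideanSpace.complexify ∘ u₂) k‖ ^ 2 ≤ C) →
      (∫ x, ‖(ν • laplacian u₁ x - (convect u₁ u₁ x - Torus.gradient (invLaplacian (divergence (convect u₁ u₁))) x)) -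
          (ν • laplacian u₂ x - (convect u₂ u₂ x - Torus.gradient (invLaplacian (divergence (convect u₂ u₂))) x))‖ ^ 2) +
        gradNormSq (fun x => (ν • laplacian u₁ x - (convect u₁ u₁ x - Torus.gradient (invLaplacian (divergence (convect u₁ u₁))) x)) -
          (ν • laplacian u₂ x - (convect u₂ u₂ x - Torus.gradient (invLaplacian (divergence (convect u₂ u₂))) x))) ≤
        K * Real.sqrt ((∫ x, ‖u₁ x - u₂ x‖ ^ 2) + gradNormSq (u₁ - u₂)) := by
  obtain ⟨K, hK⟩ := exists_h1_nsVectorField_sub_le_sqrt_of_gevreyBound (d := Fin 3) (by simp) ν σ C hσ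
  exact ⟨K, fun u₁ u₂ hu₁ hu₂ _ _ hm₁ hm₂ hG₁ hG₂ => hK u₁ u₂ hu₁ hu₂ hm₁ hm₂ hG₁ hG₂⟩

end Summit.AnomalousDissipation.AnomalousDissipation.Theorems.DenseLoudDesignerForces.Ergodic

end
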